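import Literature.Topology.FourManifolds.WhiteheadCells
import Literature.Topology.FourManifolds.PLStructuresProofs
import Literature.Analysis.Convexity.SimplexTriangulationPure
import HarnessLib

/-!
# Cell triangulations adapted to finitely many simplices

A common-refinement engine for the uniqueness half of Whitehead's triangulation theorem
(Munkres, *Elementary differential topology* (1966), §7 and 10.2: "two rectilinear complexes
always intersect nicely").  Given a finite family `S` of affinely independent configurations in a
finite-dimensional real normed space `E`, a subfamily `𝒟 ⊆ S` of *domain simplices* and finitely
many further affine functionals `L₀`, `exists_cellTriangulation` produces a finite geometric
simplicial complex `P` (the chain triangulation of the arrangement of all barycentric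
functionals of affine bases through the members of `S`, together with `L₀`) such that

* `P.space = ⋃ D ∈ 𝒟, convexHull D`;
* every closed simplex of every `s ∈ S` is covered, inside `⋃ conv D`, by simplices of `P` lying
  in it (simplexwise refinement);
* every simplex `t` of `P` has a vertex `x` such that `conv t ⊆ conv s` for **every** `s ∈ S`
  whose closed simplex contains `x`, and such that the signs of the `L₀ i` on `conv t` are those
  at `x` or zero (so `conv t` lies in the grid cell of `x` when `L₀` are grid functionals).

Consequences in this file: a finite complex with prescribed local behaviour around a compact set
(`exists_complex_of_local`: if every point of a compact `C` has a finite complex neighbourhood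
inside `U` all of whose simplices are *good*, for a property inherited by simplices inside good
closed simplices, then a single finite complex with `C` in the interior of its underlying space,
inside `U`, has only good simplices — used with "the PD map has a smooth immersive model on the
simplex" and with "the PL map is affine on the simplex"), and pure subcomplexes containing the
interior (`exists_pure_subcomplex`).

No named facts are introduced. [folklore]

## References

* J.R. Munkres, *Elementary differential topology*, Ann. of Math. Studies 54 (1963; rev. 1966),
  §7 (7.8–7.10) and 10.2. [Munkres1966]
-/

open Set Function
open scoped Topology

noncomputable section

namespace Literature.Topology.FourManifolds

open Literature.Analysis.Convexity Literature.Analysis.Convexity.SignArrangement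

section AffineBases

variable {E : Type*} [NormedAddCommGroup E] [NormedSpace ℝ E] [FiniteDimensional ℝ E]

/-- Every affinely independent finite configuration is part of an affine basis indexed by
`Fin (dim E + 1)`. [folklore] -/
theorem exists_affineBasis_superset {s : Finset E} (hs : AffineIndependent ℝ ((↑) : s → E)) :
    ∃ β : AffineBasis (Fin (Module.finrank ℝ E + 1)) ℝ E, (s : Set E) ⊆ range β := by
  obtain ⟨T, hsT, hTind, hTtot⟩ := exists_subset_affineIndependent_affineSpan_eq_top hs
  haveI : Fintype T := (finite_set_of_fin_dim_affineIndependent ℝ hTind).fintype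
  have hcard : Fintype.card T = Module.finrank ℝ E + 1 :=
    hTind.affineSpan_eq_top_iff_card_eq_finrank_add_one.1 (by rwa [Subtype.range_coe])
  let β : AffineBasis T ℝ E := ⟨(↑), hTind, by rw [Subtype.range_coe]; exact hTtot⟩
  refine ⟨β.reindex (Fintype.equivFinOfCardEq hcard), fun x hx => ?_⟩
  refine ⟨Fintype.equivFinOfCardEq hcard ⟨x, hsT hx⟩, ?_⟩
  rw [AffineBasis.coe_reindex, Function.comp_apply, Equiv.symm_apply_apply]
  rfl

end AffineBases

section Engine

variable {E : Type*} [NormedAddCommGroup E] [NormedSpace ℝ E] [FiniteDimensional ℝ E]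

/-- **Cell triangulation adapted to finitely many simplices.** See the module docstring.
[cite: Munkres1966, Lemma 7.8 and 10.2] -/
theorem exists_cellTriangulation (S : Finset (Finset E))
    (hS : ∀ s ∈ S, AffineIndependent ℝ ((↑) : s → E)) (𝒟 : Finset (Finset E)) (h𝒟 : 𝒟 ⊆ S)
    {ι₀ : Type*} [Fintype ι₀] (L₀ : ι₀ → E →ᵃ[ℝ] ℝ) :
    ∃ P : Geometry.SimplicialComplex ℝ E, P.faces.Finite ∧
      (P.space = ⋃ D ∈ 𝒟, convexHull ℝ (D : Set E)) ∧
      (∀ s ∈ S, ∀ y ∈ convexHull ℝ (s : Set E), (∃ D ∈ 𝒟, y ∈ convexHull ℝ (D : Set E)) →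
        ∃ t ∈ P.faces, y ∈ convexHull ℝ (t : Set E) ∧
          convexHull ℝ (t : Set E) ⊆ convexHull ℝ (s : Set E)) ∧
      (∀ t ∈ P.faces, ∃ x ∈ t,
        (∃ D ∈ 𝒟, convexHull ℝ (t : Set E) ⊆ convexHull ℝ (D : Set E)) ∧
        (∀ s ∈ S, x ∈ convexHull ℝ (s : Set E) →
          convexHull ℝ (t : Set E) ⊆ convexHull ℝ (s : Set E)) ∧
        (∀ i, ∀ y ∈ convexHull ℝ (t : Set E),
          SignType.sign (L₀ i y) = 0 ∨ SignType.sign (L₀ i y) = SignType.sign (L₀ i x))) := by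
  classical
  set d : ℕ := Module.finrank ℝ E with hd
  -- affine bases through the members of `S`
  have hβ : ∀ s ∈ S, ∃ β : AffineBasis (Fin (d + 1)) ℝ E, (s : Set E) ⊆ range β :=
    fun s hs => exists_affineBasis_superset (hS s hs)
  choose β hβ using hβ
  -- the functionals: all barycentric coordinates, and `L₀`
  let ι := (↥S × Fin (d + 1)) ⊕ ι₀
  let L : ι → E →ᵃ[ℝ] ℝ := Sum.elim (fun p => (β (p.1 : Finset E) p.1.2).coord p.2) L₀
  -- closed simplices of members of `S` are cells
  have hcell : ∀ s (hs : s ∈ S), ∃ J Z : Set ι, convexHull ℝ (s : Set E) = cellSet L J Z := by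
    intro s hs
    have h1 : (s : Set E) = β s hs '' {k | β s hs k ∈ s} := by
      ext x
      constructor
      · intro hx
        obtain ⟨k, hk⟩ := hβ s hs hx
        exact ⟨k, by rw [mem_setOf_eq, hk]; exact hx, hk⟩
      · rintro ⟨k, hk, rfl⟩
        exact hk
    refine ⟨Set.range (fun k : Fin (d + 1) => (Sum.inl (⟨s, hs⟩, k) : ι)),
      (fun k : Fin (d + 1) => (Sum.inl (⟨s, hs⟩, k) : ι)) '' {k | β s hs k ∈ s}ᶜ, ?_⟩
    rw [h1]
    exact convexHull_image_eq_cellSet (β s hs) (L := L) (fun k => Sum.inl (⟨s, hs⟩, k))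
      (fun k => rfl) _
  have hcell' : ∀ s : ↥S, ∃ J Z : Set ι, convexHull ℝ ((s : Finset E) : Set E) = cellSet L J Z :=
    fun s => hcell s s.2
  choose J Z hJZ' using hcell'
  have hJZ : ∀ s (hs : s ∈ S), convexHull ℝ (s : Set E) = cellSet L (J ⟨s, hs⟩) (Z ⟨s, hs⟩) :=
    fun s hs => hJZ' ⟨s, hs⟩
  -- the admissible sign vectors: nonempty faces inside a domain simplex
  set Φ : Finset (ι → SignType) := Finset.univ.filter fun ε =>
    (face L ε).Nonempty ∧ ∃ D ∈ 𝒟, face L ε ⊆ convexHull ℝ (D : Set E) with hΦ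
  have hmemΦ : ∀ ε, ε ∈ Φ ↔ (face L ε).Nonempty ∧ ∃ D ∈ 𝒟, face L ε ⊆ convexHull ℝ (D : Set E) :=
    fun ε => by simp [hΦ]
  -- chosen points
  have hch : ∀ ε : ι → SignType, ∃ p : E, ε ∈ Φ → p ∈ face L ε := fun ε => by
    by_cases h : ε ∈ Φ
    · obtain ⟨p, hp⟩ := ((hmemΦ ε).1 h).1
      exact ⟨p, fun _ => hp⟩
    · exact ⟨0, fun h' => (h h').elim⟩
  choose b hb using hch
  -- closed faces of admissible sign vectors lie in a domain simplex
  have hclD : ∀ ε ∈ Φ, ∃ D ∈ 𝒟, cl L ε ⊆ convexHull ℝ (D : Set E) := fun ε hε => by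
    obtain ⟨⟨p, hp⟩, D, hD, hsub⟩ := (hmemΦ ε).1 hε
    refine ⟨D, hD, ?_⟩
    rw [hJZ D (h𝒟 hD)] at hsub ⊢
    exact cl_subset_cellSet ⟨p, hp, hsub hp⟩
  have hdown : ∀ ε ∈ Φ, ∀ ε', SLE ε' ε → (face L ε').Nonempty → ε' ∈ Φ :=
    fun ε hε ε' hle hne => by
      obtain ⟨D, hD, hDsub⟩ := hclD ε hε
      exact (hmemΦ ε').2 ⟨hne, D, hD, (face_subset_cl.trans (cl_mono hle)).trans hDsub⟩
  have hbdd : ∀ ε ∈ Φ, Bornology.IsBounded (cl L ε) := fun ε hε => by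
    obtain ⟨D, -, hDsub⟩ := hclD ε hε
    exact (D.finite_toSet.isCompact_convexHull (𝕜 := ℝ)).isBounded.subset hDsub
  -- the chain complex
  refine ⟨chainComplex L Φ b hb, chainComplex_faces_finite, ?_, ?_, ?_⟩
  · -- underlying space
    refine Subset.antisymm (fun x hx => ?_) (fun x hx => ?_)
    · obtain ⟨t, ht, hxt⟩ := Geometry.SimplicialComplex.mem_space_iff.1 hx
      obtain ⟨ε, hε, -, hsub⟩ := convexHull_subset_cl_of_mem_chainComplex_faces ht
      obtain ⟨D, hD, hDsub⟩ := hclD ε hε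
      exact mem_iUnion₂.2 ⟨D, hD, hDsub (hsub hxt)⟩
    · obtain ⟨D, hD, hxD⟩ := mem_iUnion₂.1 hx
      have hface : face L (svec L x) ⊆ convexHull ℝ (D : Set E) := by
        rw [hJZ D (h𝒟 hD)] at hxD ⊢
        exact face_subset_cellSet ⟨x, mem_face_svec x, hxD⟩
      have hε : svec L x ∈ Φ := (hmemΦ _).2 ⟨⟨x, mem_face_svec x⟩, D, hD, hface⟩
      exact face_subset_chainComplex_space hdown hbdd hε (mem_face_svec x)
  · -- simplexwise covering of the members of `S`
    intro s hs y hys hyD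
    obtain ⟨D, hD, hyD⟩ := hyD
    have hface : face L (svec L y) ⊆ convexHull ℝ (D : Set E) := by
      rw [hJZ D (h𝒟 hD)] at hyD ⊢
      exact face_subset_cellSet ⟨y, mem_face_svec y, hyD⟩
    have hε : svec L y ∈ Φ := (hmemΦ _).2 ⟨⟨y, mem_face_svec y⟩, D, hD, hface⟩
    obtain ⟨t, ht, -, hyt, htcl⟩ := exists_face_of_mem_face hdown hbdd hε (mem_face_svec y)
    refine ⟨t, ht, hyt, htcl.trans ?_⟩
    rw [hJZ s hs] at hys ⊢
    exact cl_subset_cellSet ⟨y, mem_face_svec y, hys⟩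
  · -- the distinguished vertex of a simplex
    intro t ht
    obtain ⟨ε, hε, hbt, hsub⟩ := convexHull_subset_cl_of_mem_chainComplex_faces ht
    have hbface : b ε ∈ face L ε := hb ε hε
    refine ⟨b ε, hbt, ?_, fun s hs hxs => ?_, fun i y hy => ?_⟩
    · obtain ⟨D, hD, hDsub⟩ := hclD ε hε
      exact ⟨D, hD, hsub.trans hDsub⟩
    · refine hsub.trans ?_
      rw [hJZ s hs] at hxs ⊢
      exact cl_subset_cellSet ⟨b ε, hbface, hxs⟩
    · have hsle : SLE (svec L y) ε := mem_cl_iff_sle.1 (hsub hy)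
      have hεx : ε = svec L (b ε) := (mem_face_iff.1 hbface).symm
      rcases hsle (Sum.inr i) with h0 | h1
      · exact Or.inl h0
      · right
        rw [hεx] at h1
        exact h1

end Engine

/-! ### A finite complex with prescribed local behaviour around a compact set -/

section Local

variable {E : Type*} [NormedAddCommGroup E] [NormedSpace ℝ E] [FiniteDimensional ℝ E]

/-- **From local complexes to one complex.** Let `Good` be a property of finite configurations
inherited by configurations whose closed simplex lies in the closed simplex of a good one.  If
every point of the compact set `C` has a finite simplicial complex neighbourhood inside `U` all of
whose simplices are good, then there is one finite simplicial complex, with `C` in the interior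
of its underlying space and underlying space inside `U`, all of whose simplices are good; it can
moreover be taken adapted to finitely many further affine functionals `L₀` (each simplex has a
vertex whose `L₀`-signs bound those of the whole closed simplex). [cite: Munkres1966, 10.2] -/
theorem exists_complex_of_local {Good : Finset E → Prop}
    (hGood : ∀ s t : Finset E,
      convexHull ℝ (t : Set E) ⊆ convexHull ℝ (s : Set E) → Good s → Good t)
    {C U : Set E} (hC : IsCompact C)
    (hloc : ∀ a ∈ C, ∃ K : Geometry.SimplicialComplex ℝ E, K.faces.Finite ∧ K.space ∈ 𝓝 a ∧
      K.space ⊆ U ∧ ∀ s ∈ K.faces, Good s)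
    {ι₀ : Type*} [Fintype ι₀] (L₀ : ι₀ → E →ᵃ[ℝ] ℝ) :
    ∃ P : Geometry.SimplicialComplex ℝ E, P.faces.Finite ∧ C ⊆ interior P.space ∧
      P.space ⊆ U ∧ (∀ t ∈ P.faces, Good t) ∧
      (∀ t ∈ P.faces, ∃ x ∈ t, ∀ i, ∀ y ∈ convexHull ℝ (t : Set E),
        SignType.sign (L₀ i y) = 0 ∨ SignType.sign (L₀ i y) = SignType.sign (L₀ i x)) := by
  classical
  -- local complexes and small simplices inside them
  have hsmall : ∀ a ∈ C, ∃ K : Geometry.SimplicialComplex ℝ E, ∃ D : Finset E, K.faces.Finite ∧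
      K.space ⊆ U ∧ (∀ s ∈ K.faces, Good s) ∧ AffineIndependent ℝ ((↑) : D → E) ∧
      convexHull ℝ (D : Set E) ∈ 𝓝 a ∧ convexHull ℝ (D : Set E) ⊆ K.space := by
    intro a ha
    obtain ⟨K, hKfin, hKa, hKU, hKgood⟩ := hloc a ha
    obtain ⟨D, hDind, -, hDa, hDK⟩ := exists_affineIndependent_convexHull_subset hKa
    exact ⟨K, D, hKfin, hKU, hKgood, hDind, hDa, hDK⟩
  choose! K D hKfin hKU hKgood hDind hDa hDK using hsmall
  -- a finite subcover of `C` by the interiors of the small simplices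
  obtain ⟨A, hAC, hcov⟩ := hC.elim_nhds_subcover (fun a => interior (convexHull ℝ (D a : Set E)))
    fun a ha => interior_mem_nhds.2 (hDa a ha)
  -- all the simplices in sight
  set S₀ : Set (Finset E) := (↑(A.image D) : Set (Finset E)) ∪ ⋃ a ∈ A, (K a).faces with hS₀
  have hS₀fin : S₀.Finite :=
    (A.image D).finite_toSet.union (A.finite_toSet.biUnion fun a ha => hKfin a (hAC a ha))
  set S : Finset (Finset E) := hS₀fin.toFinset with hS
  have hmemS : ∀ s, s ∈ S ↔ s ∈ A.image D ∨ ∃ a ∈ A, s ∈ (K a).faces := fun s => by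
    rw [hS, Set.Finite.mem_toFinset, hS₀]
    simp only [mem_union, Finset.mem_coe, mem_iUnion, exists_prop]
  have hSind : ∀ s ∈ S, AffineIndependent ℝ ((↑) : s → E) := fun s hs => by
    rcases (hmemS s).1 hs with h | ⟨a, ha, h⟩
    · obtain ⟨a, ha, rfl⟩ := Finset.mem_image.1 h
      exact hDind a (hAC a ha)
    · exact (K a).indep h
  have h𝒟S : A.image D ⊆ S := fun s hs => (hmemS s).2 (Or.inl hs)
  obtain ⟨P, hPfin, hPspace, -, hPvert⟩ := exists_cellTriangulation S hSind (A.image D) h𝒟S L₀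
  refine ⟨P, hPfin, fun c hc => ?_, ?_, fun t ht => ?_, fun t ht => ?_⟩
  · -- `C ⊆ interior P.space`
    obtain ⟨a, ha, hca⟩ := mem_iUnion₂.1 (hcov hc)
    refine interior_mono ?_ hca
    rw [hPspace]
    exact subset_iUnion₂_of_subset (D a) (Finset.mem_image_of_mem D ha) Subset.rfl
  · -- `P.space ⊆ U`
    rw [hPspace]
    intro x hx
    obtain ⟨D', hD', hxD'⟩ := mem_iUnion₂.1 hx
    obtain ⟨a, ha, rfl⟩ := Finset.mem_image.1 hD'
    exact hKU a (hAC a ha) (hDK a (hAC a ha) hxD')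
  · -- goodness
    obtain ⟨x, hxt, ⟨D', hD', htD'⟩, hxS, -⟩ := hPvert t ht
    obtain ⟨a, ha, rfl⟩ := Finset.mem_image.1 hD'
    have hxK : x ∈ (K a).space := hDK a (hAC a ha) (htD' (subset_convexHull ℝ _ hxt))
    obtain ⟨u, hu, hxu⟩ := Geometry.SimplicialComplex.mem_space_iff.1 hxK
    exact hGood u t (hxS u ((hmemS u).2 (Or.inr ⟨a, ha, hu⟩)) hxu) (hKgood a (hAC a ha) u hu)
  · obtain ⟨x, hxt, -, -, hsign⟩ := hPvert t ht
    exact ⟨x, hxt, hsign⟩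

end Local

/-! ### Pure subcomplexes -/

section Pure

variable {E : Type*} [NormedAddCommGroup E] [NormedSpace ℝ E] [FiniteDimensional ℝ E]

/-- **The pure part.** The faces of the top-dimensional simplices of a finite complex form a
subcomplex, pure of dimension `dim E`, whose underlying space contains the interior of the
underlying space of the complex (interior points lie in top-dimensional simplices,
`exists_mem_faces_affineSpan_eq_top_of_mem_interior`). [folklore] -/
theorem exists_pure_subcomplex (P : Geometry.SimplicialComplex ℝ E) (hfin : P.faces.Finite) :
    ∃ P' : Geometry.SimplicialComplex ℝ E, P'.faces ⊆ P.faces ∧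
      interior P.space ⊆ P'.space ∧ P'.space ⊆ P.space ∧
      ∀ t ∈ P'.faces, ∃ s ∈ P'.faces, t ⊆ s ∧ s.card = Module.finrank ℝ E + 1 := by
  classical
  set F : Set (Finset E) := {t | t ∈ P.faces ∧ ∃ s ∈ P.faces, t ⊆ s ∧
    s.card = Module.finrank ℝ E + 1} with hF
  have hFP : F ⊆ P.faces := fun t ht => ht.1
  have hdown : ∀ s ∈ F, ∀ t ⊆ s, t.Nonempty → t ∈ F := fun s hs t hts htne =>
    ⟨P.down_closed hs.1 hts htne, by
      obtain ⟨u, hu, hsu, hcard⟩ := hs.2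
      exact ⟨u, hu, hts.trans hsu, hcard⟩⟩
  refine ⟨subcomplexOf P F hFP hdown, hFP, fun x hx => ?_, fun x hx => ?_, fun t ht => ?_⟩
  · obtain ⟨s, hs, htop, hxs⟩ := exists_mem_faces_affineSpan_eq_top_of_mem_interior hfin hx
    have hcard : s.card = Module.finrank ℝ E + 1 := by
      have h := (P.indep hs).affineSpan_eq_top_iff_card_eq_finrank_add_one.1
        (by rwa [Subtype.range_coe])
      rwa [Fintype.card_coe] at h
    exact Geometry.SimplicialComplex.mem_space_iff.2 ⟨s, ⟨hs, s, hs, Subset.rfl, hcard⟩, hxs⟩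
  · obtain ⟨s, hs, hxs⟩ := Geometry.SimplicialComplex.mem_space_iff.1 hx
    exact Geometry.SimplicialComplex.mem_space_iff.2 ⟨s, hFP hs, hxs⟩
  · obtain ⟨s, hs, hts, hcard⟩ := (show t ∈ F from ht).2
    exact ⟨s, ⟨hs, s, hs, Subset.rfl, hcard⟩, hts, hcard⟩

end Pure



/-! ### Refining a given complex -/

section Refine

variable {E : Type*} [NormedAddCommGroup E] [NormedSpace ℝ E] [FiniteDimensional ℝ E]

/-- **Adapted refinement of a finite complex.** A finite complex `K` has a finite refinement `P`
(same underlying space, every simplex of `P` inside a simplex of `K`, every closed simplex of `K`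
covered simplexwise) adapted to finitely many further affinely independent configurations `S'`
and affine functionals `L₀`: each simplex of `P` has a vertex `x` with `conv t ⊆ conv s` for every
`s ∈ K.faces ∪ S'` whose closed simplex contains `x`, and with the `L₀`-signs on `conv t` bounded
by those at `x`. [cite: Munkres1966, Lemma 7.8 and 7.10] -/
theorem exists_adapted_refinement (K : Geometry.SimplicialComplex ℝ E) (hK : K.faces.Finite)
    (S' : Finset (Finset E)) (hS' : ∀ s ∈ S', AffineIndependent ℝ ((↑) : s → E))
    {ι₀ : Type*} [Fintype ι₀] (L₀ : ι₀ → E →ᵃ[ℝ] ℝ) :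
    ∃ P : Geometry.SimplicialComplex ℝ E, P.faces.Finite ∧ P.space = K.space ∧
      (∀ t ∈ P.faces, ∃ s ∈ K.faces, convexHull ℝ (t : Set E) ⊆ convexHull ℝ (s : Set E)) ∧
      (∀ s ∈ K.faces, ∀ y ∈ convexHull ℝ (s : Set E), ∃ t ∈ P.faces,
        y ∈ convexHull ℝ (t : Set E) ∧ convexHull ℝ (t : Set E) ⊆ convexHull ℝ (s : Set E)) ∧
      (∀ t ∈ P.faces, ∃ x ∈ t,
        (∀ s, s ∈ K.faces ∨ s ∈ S' → x ∈ convexHull ℝ (s : Set E) →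
          convexHull ℝ (t : Set E) ⊆ convexHull ℝ (s : Set E)) ∧
        (∀ i, ∀ y ∈ convexHull ℝ (t : Set E),
          SignType.sign (L₀ i y) = 0 ∨ SignType.sign (L₀ i y) = SignType.sign (L₀ i x))) := by
  classical
  set S : Finset (Finset E) := hK.toFinset ∪ S' with hS
  have hmemS : ∀ s, s ∈ S ↔ s ∈ K.faces ∨ s ∈ S' := fun s => by
    rw [hS, Finset.mem_union, Set.Finite.mem_toFinset]
  have hSind : ∀ s ∈ S, AffineIndependent ℝ ((↑) : s → E) := fun s hs => by
    rcases (hmemS s).1 hs with h | h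
    · exact K.indep h
    · exact hS' s h
  have h𝒟 : hK.toFinset ⊆ S := Finset.subset_union_left
  obtain ⟨P, hPfin, hPspace, hPcov, hPvert⟩ := exists_cellTriangulation S hSind hK.toFinset h𝒟 L₀
  have hspace : P.space = K.space := by
    rw [hPspace]
    refine Subset.antisymm (fun x hx => ?_) (fun x hx => ?_)
    · obtain ⟨D, hD, hxD⟩ := mem_iUnion₂.1 hx
      exact Geometry.SimplicialComplex.convexHull_subset_space (hK.mem_toFinset.1 hD) hxD
    · obtain ⟨s, hs, hxs⟩ := Geometry.SimplicialComplex.mem_space_iff.1 hx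
      exact mem_iUnion₂.2 ⟨s, hK.mem_toFinset.2 hs, hxs⟩
  refine ⟨P, hPfin, hspace, fun t ht => ?_, fun s hs y hy => ?_, fun t ht => ?_⟩
  · obtain ⟨x, -, ⟨D, hD, htD⟩, -, -⟩ := hPvert t ht
    exact ⟨D, hK.mem_toFinset.1 hD, htD⟩
  · exact hPcov s ((hmemS s).2 (Or.inl hs)) y hy ⟨s, hK.mem_toFinset.2 hs, hy⟩
  · obtain ⟨x, hxt, -, hxS, hsign⟩ := hPvert t ht
    exact ⟨x, hxt, fun s hs hxs => hxS s ((hmemS s).2 hs) hxs, hsign⟩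

end Refine

/-! ### Grid functionals and mesh -/

section Grid

/-- The grid functionals of mesh `1/m` on the cube `[-R, R]ⁿ` of `ℝⁿ`: `x ↦ x i - (k/m - R)`,
`0 ≤ k ≤ 2 R m`. [folklore] -/
def gridFun (n m R : ℕ) (p : Fin n × Fin (2 * R * m + 1)) : EuclideanSpace ℝ (Fin n) →ᵃ[ℝ] ℝ :=
  (EuclideanSpace.proj p.1 : EuclideanSpace ℝ (Fin n) →L[ℝ] ℝ).toContinuousAffineMap.toAffineMap -
    AffineMap.const ℝ (EuclideanSpace ℝ (Fin n)) ((p.2 : ℝ) / m - R)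

/-- Auxiliary (`gridFun_apply`). [folklore] -/
theorem gridFun_apply (n m R : ℕ) (p : Fin n × Fin (2 * R * m + 1)) (x : EuclideanSpace ℝ (Fin n)) :
    gridFun n m R p x = x p.1 - ((p.2 : ℝ) / m - R) := rfl

/-- **Mesh from grid signs.** If the signs of all grid functionals on a set `T` are bounded by
those at a point `x` of the cube `[-R, R]ⁿ` (in the sense of `exists_cellTriangulation`), every
point of `T` is coordinatewise within `1/m` of `x`. [folklore] -/
theorem abs_sub_le_of_grid_signs {n m R : ℕ} (hm : 0 < m) {x : EuclideanSpace ℝ (Fin n)}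
    (hx : ∀ i, |x i| ≤ R) {T : Set (EuclideanSpace ℝ (Fin n))}
    (hsign : ∀ p, ∀ y ∈ T, SignType.sign (gridFun n m R p y) = 0 ∨
      SignType.sign (gridFun n m R p y) = SignType.sign (gridFun n m R p x))
    {y : EuclideanSpace ℝ (Fin n)} (hy : y ∈ T) (i : Fin n) : |y i - x i| ≤ 1 / m := by
  have hm' : (0 : ℝ) < m := by exact_mod_cast hm
  have hxi := abs_le.1 (hx i)
  -- the grid level just below `x i`
  obtain ⟨k₀, hk₀⟩ : ∃ k₀ : ℕ, (k₀ : ℝ) ≤ (x i + R) * m ∧ (x i + R) * m < k₀ + 1 :=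
    ⟨⌊(x i + R) * m⌋₊, Nat.floor_le (by nlinarith), Nat.lt_floor_add_one _⟩
  have hk₀le : k₀ ≤ 2 * R * m := by
    have h1 : (k₀ : ℝ) ≤ 2 * R * m := hk₀.1.trans (by nlinarith)
    exact_mod_cast h1
  -- signs at a level `k`: the value at `z` is `z i - (k/m - R)`
  have hval : ∀ (k : Fin (2 * R * m + 1)) (z : EuclideanSpace ℝ (Fin n)),
      gridFun n m R (i, k) z = z i - ((k : ℕ) / m - R) := fun k z => by
    rw [gridFun_apply]
  have key : ∀ (k : Fin (2 * R * m + 1)),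
      (0 ≤ gridFun n m R (i, k) x → 0 ≤ gridFun n m R (i, k) y) ∧
      (gridFun n m R (i, k) x ≤ 0 → gridFun n m R (i, k) y ≤ 0) := by
    intro k
    rcases hsign (i, k) y hy with h0 | h1
    · rw [sign_eq_zero_iff] at h0
      exact ⟨fun _ => h0.symm.le, fun _ => h0.le⟩
    · constructor
      · intro hxk
        rcases hxk.lt_or_eq with hlt | heq
        · rw [sign_pos hlt] at h1
          by_contra hneg
          push Not at hneg
          rw [sign_neg hneg] at h1
          exact absurd h1 (by decide)
        · by_contra hneg
          push Not at hneg
          rw [sign_neg hneg, ← heq, sign_zero] at h1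
          exact absurd h1 (by decide)
      · intro hxk
        rcases hxk.lt_or_eq with hlt | heq
        · rw [sign_neg hlt] at h1
          by_contra hpos
          push Not at hpos
          rw [sign_pos hpos] at h1
          exact absurd h1 (by decide)
        · by_contra hpos
          push Not at hpos
          rw [sign_pos hpos, heq, sign_zero] at h1
          exact absurd h1 (by decide)
  -- the level `ℓ₀ = k₀/m - R` satisfies `ℓ₀ ≤ x i < ℓ₀ + 1/m`
  have hℓ₀ : (k₀ : ℝ) / m - R ≤ x i := by
    have : (k₀ : ℝ) / m ≤ x i + R := by rw [div_le_iff₀ hm']; exact hk₀.1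
    linarith
  have hℓ₁ : x i < ((k₀ : ℝ) + 1) / m - R := by
    have : x i + R < ((k₀ : ℝ) + 1) / m := by rw [lt_div_iff₀ hm']; exact hk₀.2
    linarith
  have h1m : ((k₀ : ℝ) + 1) / m = (k₀ : ℝ) / m + 1 / m := by rw [add_div]
  -- lower bound from level `k₀`
  have hlow : x i - 1 / m ≤ y i := by
    have h := (key ⟨k₀, Nat.lt_succ_of_le hk₀le⟩).1
    rw [hval, hval] at h
    have h' := h (by push_cast; linarith)
    push_cast at h'
    linarith
  -- upper bound from level `k₀ + 1` (or `k₀` itself at the top face of the cube)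
  have hup : y i ≤ x i + 1 / m := by
    rcases Nat.lt_or_ge k₀ (2 * R * m) with hlt | hge
    · have h := (key ⟨k₀ + 1, Nat.succ_lt_succ hlt⟩).2
      rw [hval, hval] at h
      have h' := h (by push_cast; linarith)
      push_cast at h'
      linarith
    · have hk : k₀ = 2 * R * m := le_antisymm hk₀le hge
      have hℓR : (k₀ : ℝ) / m - R = R := by
        rw [hk]; push_cast; field_simp; ring
      have hxR : x i = R := le_antisymm hxi.2 (by linarith)
      have h := (key ⟨k₀, Nat.lt_succ_of_le hk₀le⟩).2
      rw [hval, hval] at h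
      have h' := h (by push_cast; linarith)
      push_cast at h'
      have : (0 : ℝ) ≤ 1 / m := by positivity
      linarith
  rw [abs_le]
  constructor <;> linarith

/-- The same in terms of the norm: `‖y - x‖ ≤ √n / m`. [folklore] -/
theorem norm_sub_le_of_grid_signs {n m R : ℕ} (hm : 0 < m) {x : EuclideanSpace ℝ (Fin n)}
    (hx : ∀ i, |x i| ≤ R) {T : Set (EuclideanSpace ℝ (Fin n))}
    (hsign : ∀ p, ∀ y ∈ T, SignType.sign (gridFun n m R p y) = 0 ∨
      SignType.sign (gridFun n m R p y) = SignType.sign (gridFun n m R p x))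
    {y : EuclideanSpace ℝ (Fin n)} (hy : y ∈ T) : ‖y - x‖ ≤ Real.sqrt n / m := by
  have hm' : (0 : ℝ) < m := by exact_mod_cast hm
  have hcoord : ∀ i, |(y - x) i| ≤ 1 / m := fun i => by
    rw [PiLp.sub_apply]
    exact abs_sub_le_of_grid_signs hm hx hsign hy i
  rw [EuclideanSpace.norm_eq]
  have hsum : ∑ i, |(y - x) i| ^ 2 ≤ n * (1 / m) ^ 2 := by
    calc ∑ i, |(y - x) i| ^ 2 ≤ ∑ _i : Fin n, (1 / (m : ℝ)) ^ 2 :=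
          Finset.sum_le_sum fun i _ => pow_le_pow_left₀ (abs_nonneg _) (hcoord i) 2
      _ = n * (1 / m) ^ 2 := by rw [Finset.sum_const, Finset.card_univ, Fintype.card_fin]; ring
  calc Real.sqrt (∑ i, |(y - x) i| ^ 2) ≤ Real.sqrt (n * (1 / m) ^ 2) := Real.sqrt_le_sqrt hsum
    _ = Real.sqrt n / m := by
      rw [Real.sqrt_mul (Nat.cast_nonneg n), Real.sqrt_sq (by positivity)]
      ring

end Grid

end Literature.Topology.FourManifolds
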